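import Summits.MatrixMultiplication.MatrixMultiplication.Theorems.SoloInformedTwistedMatchingsProductHost
import HarnessLib

/-!
# `ℤ/p^k`, `k → ∞`, and the exact range of Theorem B″

Solo-informed seat (MatrixMultiplication), gen 101; sharpest-statement §2y(8), clause (d).
`exists_behrend_gt`: the analytic heart of the converse side, once and for all — for `δ > 0` and
`C > 0`, `C·N^{1-δ} < N e^{-4√(log N)}` for all large `N`. Consequences:
`not_primePow_matching_bound` — for every fixed `p ≥ 2` there is no `δ > 0` bounding untwisted
matchings in all `ℤ/p^k` by `3 (p^k)^{1-δ}` (Cohn–Umans 2013 §5's regime "`ℤ/p^k`, `k → ∞`" is out of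
reach of the slice-rank method even at fixed `p`); and `not_exists_uniform_exp_delta` — in
`exists_expTwistedMatching_card_le` (Theorem B″) the saving `δ(m)` cannot be chosen independently of
the exponent `m`: the statement of B″ with the quantifiers `∃ δ ∀ m` is FALSE. So B″ — "translation
schemes over abelian groups of exponent dividing `m` realize `⟨n,n,n⟩` only at size
`≥ n^{(2-o(1))/(1-δ(m))}`" — is sharp in its dependence on `m` at the level of the method AND of the
statement.
References: Behrend (1946); CohnUmans2013 (arXiv:1207.6528) §5; BCCGNSU17 (arXiv:1605.06702) §1.
-/

noncomputable section

open scoped BigOperators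
open Finset

namespace Summit.MatrixMultiplication.MatrixMultiplication.Theorems.TwistedSliceRank

section PrimePowerHost

/-- **Behrend beats every power saving**: for `δ > 0`, `C > 0` and all large `N`,
`C · N^{1-δ} < N · e^{-4√(log N)}`. [standard real analysis; this file's engine] -/
theorem exists_behrend_gt (δ : ℝ) (hδ : 0 < δ) (C : ℝ) (hC : 0 < C) :
    ∃ N₀ : ℕ, ∀ N : ℕ, N₀ ≤ N →
      C * (N : ℝ) ^ (1 - δ) < (N : ℝ) * Real.exp (-4 * Real.sqrt (Real.log N)) := by
  -- reduce to `δ ≤ 1`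
  set δ' : ℝ := min δ 1 with hδ'
  have hδ'0 : 0 < δ' := lt_min hδ one_pos
  have hδ'1 : δ' ≤ 1 := min_le_right _ _
  have hδ'δ : δ' ≤ δ := min_le_left _ _
  set L : ℝ := max (Real.log C) 0 with hL
  have hL0 : 0 ≤ L := le_max_right _ _
  have hLC : Real.log C ≤ L := le_max_left _ _
  set t₀ : ℝ := (5 + L) / δ' with ht₀
  have ht₀5 : 5 ≤ t₀ := by
    rw [ht₀, le_div_iff₀ hδ'0]; nlinarith
  have ht₀0 : 0 < t₀ := by linarith
  refine ⟨⌈Real.exp (t₀ ^ 2)⌉₊, fun N hN => ?_⟩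
  have hNexp : Real.exp (t₀ ^ 2) ≤ (N : ℝ) := (Nat.le_ceil _).trans (by exact_mod_cast hN)
  have hN1 : (1 : ℝ) ≤ N :=
    le_trans (by linarith [Real.add_one_le_exp (t₀ ^ 2), sq_nonneg t₀]) hNexp
  have hN0 : (0 : ℝ) < N := by linarith
  -- `log N ≥ t₀²`, `s = √(log N) ≥ t₀`
  have hu : t₀ ^ 2 ≤ Real.log N := by
    have h := Real.log_le_log (Real.exp_pos _) hNexp
    rwa [Real.log_exp] at h
  have hu0 : 0 ≤ Real.log N := le_trans (sq_nonneg _) hu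
  set s : ℝ := Real.sqrt (Real.log N) with hs
  have hst : t₀ ≤ s := by
    rw [hs, ← Real.sqrt_sq ht₀0.le]
    exact Real.sqrt_le_sqrt hu
  have hs0 : 0 ≤ s := ht₀0.le.trans hst
  have hss : s ^ 2 = Real.log N := by rw [hs]; exact Real.sq_sqrt hu0
  have hδt : δ' * t₀ = 5 + L := by rw [ht₀]; field_simp
  have hδs : 5 + L ≤ δ' * s := by rw [← hδt]; exact mul_le_mul_of_nonneg_left hst hδ'0.le
  -- `δ' log N - 4 s > log C`
  have hkey : Real.log C < δ' * Real.log N - 4 * s := by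
    have h4 : t₀ * (1 + L) ≤ s * (δ' * s - 4) :=
      mul_le_mul hst (by linarith) (by linarith) hs0
    have h5 : L < t₀ * (1 + L) := by nlinarith
    calc Real.log C ≤ L := hLC
      _ < t₀ * (1 + L) := h5
      _ ≤ s * (δ' * s - 4) := h4
      _ = δ' * s ^ 2 - 4 * s := by ring
      _ = δ' * Real.log N - 4 * s := by rw [hss]
  have hlower : C < (N : ℝ) ^ δ' * Real.exp (-4 * s) := by
    rw [Real.rpow_def_of_pos hN0, ← Real.exp_add]
    calc C = Real.exp (Real.log C) := (Real.exp_log hC).symm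
      _ < Real.exp (Real.log N * δ' + (-4 * s)) := Real.exp_lt_exp.2 (by linarith)
  -- assemble
  have hsplit : (N : ℝ) = (N : ℝ) ^ (1 - δ') * (N : ℝ) ^ δ' := by
    rw [← Real.rpow_add hN0, sub_add_cancel, Real.rpow_one]
  have hmono : (N : ℝ) ^ (1 - δ) ≤ (N : ℝ) ^ (1 - δ') :=
    Real.rpow_le_rpow_of_exponent_le hN1 (by linarith)
  calc C * (N : ℝ) ^ (1 - δ) ≤ C * (N : ℝ) ^ (1 - δ') := mul_le_mul_of_nonneg_left hmono hC.le
    _ = (N : ℝ) ^ (1 - δ') * C := mul_comm _ _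
    _ < (N : ℝ) ^ (1 - δ') * ((N : ℝ) ^ δ' * Real.exp (-4 * s)) :=
        mul_lt_mul_of_pos_left hlower (Real.rpow_pos_of_pos hN0 _)
    _ = (N : ℝ) * Real.exp (-4 * s) := by rw [← mul_assoc, ← hsplit]

/-- **`ℤ/p^k`, `k → ∞`, at fixed `p`.** For every `p ≥ 2` there is no `δ > 0` bounding untwisted
matchings in all cyclic groups `ℤ/p^k` by `3 (p^k)^{1-δ}`. [this work] -/
theorem not_primePow_matching_bound (p : ℕ) (hp : 2 ≤ p) :
    ¬ ∃ δ : ℝ, 0 < δ ∧ ∀ (k : ℕ) (ι : Type) [Fintype ι]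
        (x y z : ι → Multiplicative (ZMod (p ^ k))),
        (∀ i j l : ι, (x i * y j * z l = 1) ↔ (i = j ∧ j = l)) →
        (Fintype.card ι : ℝ) ≤ 3 * ((p : ℝ) ^ k) ^ (1 - δ) := by
  rintro ⟨δ, hδ, hB⟩
  obtain ⟨N₀, hN₀⟩ := exists_behrend_gt δ hδ 9 (by norm_num)
  set k : ℕ := 2 * (N₀ + 1) with hk
  have hpk : 2 * (N₀ + 1) ≤ p ^ k :=
    (Nat.lt_pow_self (by omega : 1 < p)).le
  haveI : NeZero (p ^ k) := ⟨pow_ne_zero _ (by omega)⟩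
  set N : ℕ := p ^ k / 2 with hN
  have hN₀N : N₀ ≤ N := by omega
  have hN1 : 1 ≤ N := by omega
  have h2N : 2 * N ≤ p ^ k := by omega
  have hP3N : p ^ k ≤ 3 * N := by omega
  obtain ⟨t, htN, htcard, ht⟩ := rothNumberNat_spec N
  obtain ⟨x, y, z, hm⟩ := threeAPFree_matching_zmod N ht htN (p ^ k) h2N
  have h1 := hB k ↥t x y z hm
  rw [Fintype.card_coe, htcard] at h1
  have hN0 : (0 : ℝ) < N := by exact_mod_cast hN1
  have hP0 : (0 : ℝ) < (p : ℝ) ^ k := by positivity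
  have hNP : (N : ℝ) ≤ (p : ℝ) ^ k := by exact_mod_cast (show N ≤ p ^ k by omega)
  have hP3 : (p : ℝ) ^ k ≤ 3 * N := by exact_mod_cast hP3N
  have h2 : ((p : ℝ) ^ k) ^ (1 - δ) ≤ 3 * (N : ℝ) ^ (1 - δ) := by
    rw [Real.rpow_sub hP0, Real.rpow_one, Real.rpow_sub hN0, Real.rpow_one]
    rw [div_eq_mul_inv, div_eq_mul_inv, ← mul_assoc]
    refine mul_le_mul hP3 ?_ (inv_nonneg.2 (Real.rpow_nonneg hP0.le _)) (by positivity)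
    exact inv_anti₀ (Real.rpow_pos_of_pos hN0 _) (Real.rpow_le_rpow hN0.le hNP hδ.le)
  have hBeh : (N : ℝ) * Real.exp (-4 * Real.sqrt (Real.log N)) ≤ (rothNumberNat N : ℝ) :=
    Behrend.roth_lower_bound
  have h3 := hN₀ N hN₀N
  linarith

/-- **B″'s dependence on the exponent is genuine.** There is no single `δ > 0` serving all
exponents `m` in `exists_expTwistedMatching_card_le`: the statement "∃ δ > 0 ∀ m ∀ S abelian with
`g^m = 1` ∀ automorphism-pair twists ∀ twisted matchings: `|ι| ≤ 3|S|^{1-δ}`" is false (cyclic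
hosts, identity twists, `not_cyclic_matching_bound`). [this work] -/
theorem not_exists_uniform_exp_delta :
    ¬ ∃ δ : ℝ, 0 < δ ∧ ∀ (m : ℕ), 0 < m → ∀ (S : Type) [CommGroup S] [Fintype S] [DecidableEq S],
      (∀ g : S, g ^ m = 1) →
      ∀ (σ : Type) [Fintype σ] (φ ψ : σ → S ≃* S) (ι : Type) [Fintype ι] (x y z : ι → S),
      (∀ i j l : ι, (∃ s : σ, x i * φ s (y j) * ψ s (z l) = 1) ↔ (i = j ∧ j = l)) →
      (Fintype.card ι : ℝ) ≤ 3 * (Fintype.card S : ℝ) ^ (1 - δ) := by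
  rintro ⟨δ, hδ, hB⟩
  refine not_cyclic_matching_bound ⟨δ, hδ, fun M _ ι _ x y z hm => ?_⟩
  have hexp : ∀ g : Multiplicative (ZMod M), g ^ M = 1 := fun g => by
    have h : g ^ Fintype.card (Multiplicative (ZMod M)) = 1 := pow_card_eq_one
    simpa only [Fintype.card_multiplicative, ZMod.card] using h
  have h := hB M (Nat.pos_of_ne_zero (NeZero.ne M)) (Multiplicative (ZMod M)) hexp Unit
    (fun _ => MulEquiv.refl _) (fun _ => MulEquiv.refl _) ι x y z (fun i j l => by
      rw [← hm i j l]; simp only [MulEquiv.refl_apply, exists_const])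
  simpa only [Fintype.card_multiplicative, ZMod.card] using h

end PrimePowerHost

end Summit.MatrixMultiplication.MatrixMultiplication.Theorems.TwistedSliceRank
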